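/-
Copyright (c) 2026 the pub-hodgecm-mathlib formalisation cell (harness21).  Prover seat hodgecm-mathlib-LH4-p04 (g2), req620 Track A «(D-RAM) FOUR-FRAME» squad
(unit U3_Laws, (KMS) road «MODULO κ-STAGE B», brick κB-T «T-STRATA κ-SOCKETS», dealer LH4-plan (g11) WORD #35 (2); letters F0P3a-p01 (g32) 2026-09-04T01:25:48Z (B)):
a σ-FIXED NON-NORM UNIT AT EVERY LEVEL BELOW THE CONDUCTOR — the norm-residue character is non-trivial on `U_F^{(n)}` for every `n ≤ d − 1`.  2026-09-04.
-/
import Literature.NumberTheory.LocalFields.WildQuadraticDatumNonNormUnit   -- ★ (LH4-p09 (g2)): `exists_fixed_unit_not_norm_of_isRamifiedQuadraticDatum`; brings ★ graded steps `exists_norm_approx_below_break`, ★ datum toolkit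
import HarnessLib

/-!
# A σ-fixed unit which is NOT a norm at every level `n ≤ d − 1` below the conductor: `ω_{K∕F}` is non-trivial on `U_F^{(d−1)}`
# (Serre, *Local Fields* V §3 Prop. 5 (ii), Cor. 3: the conductor of a totally ramified quadratic extension with break `d − 1` is `𝔭_F^{d}`)

Topic `NumberTheory/LocalFields`; namespace `Literature.NumberTheory.LocalFields.WildQuadraticDatum` (the one-field datum ★ `IsRamifiedQuadraticDatum σ ϖ d t`: `σ` an involution of a
discretely valued field `K` with `v ∘ σ = v`, non-zero `σ`-fixed elements of even valuation, `ϖ` a uniformiser, `|ϖ − σϖ| = |ϖ|^d`, `|2| = |ϖ|^t`; the fixed field `F = K^σ` is never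
a type; `exp(−2n)` is the valuation of the `n`-th power of the `F`-uniformiser `ϖσϖ`, so «`|u − 1| ≤ exp(−2n)`» reads `u ∈ U_F^{(n)}`).  THEOREMS ONLY (no definition, no instance, no
notation, no named fact, no `sorry`).  Cell `pub/hodgecm-mathlib` (D-0151), crux H413 = `stmt-HodgeConjecture-24833`; road «(D-RAM) FOUR-FRAME», unit U3_Laws, (KMS) road.
WHY: the κ-Stage-B sockets (LH4-p05 (g3) PLAN v1 §4) evaluate the κ-sign of a lattice `M` as `χ_i(D₁)·[χ_i ≡ 1 on S_F(M)]`; the fixed-unit stabiliser of an on-branch lattice at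
distance `s` is the congruence group `{u₂∕u₁ ∈ U_F^{(s∕2)}}`, so «`χ_i ≡ 1 on S_F(M)`» is EXACTLY «`ω` trivial on `U_F^{(s∕2)}`» — true for `s∕2 ≥ d` by ★ deep norms
(`exists_mul_map_eq_of_isRamifiedQuadraticDatum`), and FALSE for `s∕2 ≤ d − 1` by THIS file: a non-norm fixed unit exists INSIDE `U_F^{(n)}` for every `n ≤ d − 1`.

THE MATHEMATICS (Serre V §3, `p = 2`, break `t₀ = d − 1`).  Start from the ★ non-norm fixed unit `u₀ ∈ U_F = U_F^{(0)}` (`exists_fixed_unit_not_norm_of_isRamifiedQuadraticDatum`).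
Below the break the graded norm map `U_K^{(n)}∕U_K^{(n+1)} → U_F^{(n)}∕U_F^{(n+1)}` is ONTO (`ξ ↦ ξ²` on the finite residue field of characteristic two; ★ `exists_norm_approx_below_break`:
for `n + 2 ≤ d` and a fixed unit `w ∈ U_F^{(n)}` some unit `z` has `|w − zσz| ≤ exp(−2n−2)`), so `w ↦ w∕(zσz)` pushes a non-norm from level `n` to level `n + 1` without changing
its norm class; induction on `n` reaches every level `n ≤ d − 1` (the wild hypothesis `|2| < 1` needed by the graded step follows from `n + 2 ≤ d ≤ t + 1`, ★ `d_le_succ_t`).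
* `exists_fixed_unit_not_norm_succ_level` — the push `U_F^{(n)} → U_F^{(n+1)}` of a non-norm (`n + 2 ≤ d`; no completeness).
* `exists_fixed_unit_not_norm_of_level` — HEAD: for `n + 1 ≤ d` a `σ`-fixed unit `u` with `|u − 1| ≤ exp(−2n)` which is not a norm (`[IsAdicComplete 𝓂[K] 𝒪[K]]`,
  `[Finite 𝓀[K]]`, as the ★ level-`0` input).
* `exists_fixed_unit_not_norm_of_level_pow` — the same with the bound spelled `|u − 1| ≤ |ϖ ^ (2n)|` (the currency of the ★ stabiliser lemmas `|u₂ − u₁| ≤ |ϖ^s|`).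
HONEST LABEL: HC_CM is proved only modulo the 7 printed citations (2 remaining named inputs: hLiu418 = stmt-HodgeConjecture-24832, h413 = stmt-HodgeConjecture-24833) until rung 0
closes; count-neutral, nothing printed is asserted — Serre V §3 Cor. 3 (the conductor is `𝔭_F^{d}`, lower half) PROVED for `ℓ = 2` in datum currency.

## References
* [Serre1979] J.-P. Serre, *Local Fields*, GTM 67 (1979): Ch. V §3 Prop. 5 (ii)–(iii), Cor. 3 pp. 85–87 (graded norm maps of a totally ramified cyclic extension of prime
  degree; the conductor is `𝔭^{t₀+1}`), Ch. XV §2 (norm groups and the norm-residue symbol).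
* [NeukirchANT1999] J. Neukirch, *Algebraic Number Theory* (1999): Ch. V (1.3) (local norm index).
-/

set_option autoImplicit false

open WithZero
open scoped Valued

namespace Literature.NumberTheory.LocalFields.WildQuadraticDatum

open Literature.NumberTheory.Automorphic.UnitaryThreeFourFrame

variable {K : Type*} [Field K] [Valued K ℤᵐ⁰] {σ : K →+* K} {ϖ : K} {d t : ℕ}

/-! ## §1 One graded step: a non-norm at level `n` gives a non-norm at level `n + 1` (`n + 2 ≤ d`) -/

/-- **PUSHING A NON-NORM UP ONE LEVEL BELOW THE BREAK** (Serre V §3 Prop. 5 (ii)): if `n + 2 ≤ d` and `w ∈ U_F^{(n)}` is a `σ`-fixed unit which is not a norm, then — with the unit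
`z` of ★ `exists_norm_approx_below_break`, `|w − zσz| ≤ exp(−2n−2)` — the fixed unit `w∕(zσz) ∈ U_F^{(n+1)}` is not a norm either (norms multiply, ★ `mul_map_mul_map`).  The
wild hypothesis `|2| < 1` is automatic: `d ≥ 2` forces `t ≥ 1` (★ `d_le_succ_t`). [cite: Serre1979, Ch. V §3 Prop. 5 (ii)] [cite: NeukirchANT1999, Ch. V (1.3)] -/
theorem exists_fixed_unit_not_norm_succ_level [Finite 𝓀[K]] (hσ : ∀ x, σ (σ x) = x) (hvσ : ∀ a, Valued.v (σ a) = Valued.v a)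
    (hfix : ∀ x : K, σ x = x → x ≠ 0 → ∃ n : ℤ, Valued.v x = exp (2 * n)) (hϖ : Valued.v ϖ = exp (-1 : ℤ))
    (hd : Valued.v (ϖ - σ ϖ) = Valued.v ϖ ^ d) (ht : Valued.v (2 : K) = Valued.v ϖ ^ t)
    {n : ℕ} (hn : n + 2 ≤ d) {w : K} (hσw : σ w = w) (hw1 : Valued.v w = 1) (hw : Valued.v (w - 1) ≤ exp (-(2 * (n : ℤ))))
    (hwn : ¬ ∃ z : K, z * σ z = w) :
    ∃ u : K, σ u = u ∧ Valued.v u = 1 ∧ Valued.v (u - 1) ≤ exp (-(2 * ((n + 1 : ℕ) : ℤ))) ∧ ¬ ∃ z : K, z * σ z = u := by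
  -- at level `n + 2 ≤ d` the place is wild: `|2| = |ϖ|^t` with `t ≥ 1`
  have h2v : Valued.v (2 : K) < 1 := by
    have hdt := d_le_succ_t hσ hfix hϖ hd ht
    rw [ht, v_varpi_pow hϖ, ← exp_zero, exp_lt_exp]
    omega
  obtain ⟨z, hz1, hwz⟩ := exists_norm_approx_below_break hσ hvσ hfix hϖ hd ht h2v hn hσw hw1 hw
  have hN1 : Valued.v (z * σ z) = 1 := by rw [map_mul, hvσ, hz1, mul_one]
  have hN0 : z * σ z ≠ 0 := fun h => by rw [h, map_zero] at hN1; exact zero_ne_one hN1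
  have hσN : σ (z * σ z) = z * σ z := map_mul_map hσ z
  refine ⟨w * (z * σ z)⁻¹, ?_, ?_, ?_, ?_⟩
  · rw [map_mul, map_inv₀, hσw, hσN]
  · rw [map_mul, map_inv₀, hw1, hN1, inv_one, mul_one]
  · have hrw : w * (z * σ z)⁻¹ - 1 = (w - z * σ z) * (z * σ z)⁻¹ := by
      rw [sub_mul, mul_inv_cancel₀ hN0]
    rw [hrw, map_mul, map_inv₀, hN1, inv_one, mul_one]
    refine hwz.trans_eq ?_
    push_cast; ring_nf
  · rintro ⟨y, hy⟩
    refine hwn ⟨y * z, ?_⟩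
    rw [← mul_map_mul_map, hy, inv_mul_cancel_right₀ hN0]

/-! ## §2 A non-norm fixed unit at every level `n ≤ d − 1` -/

/-- **A σ-FIXED UNIT IN `U_F^{(n)}` WHICH IS NOT A NORM, FOR EVERY `n ≤ d − 1`** (Serre V §3 Cor. 3: the norm-residue character of a ramified quadratic datum with
`|ϖ − σϖ| = |ϖ|^d` is NON-TRIVIAL on `U_F^{(d−1)}`, i.e. its conductor is not smaller than `𝔭_F^{d}`): induction on `n` from the ★ level-`0` non-norm
(`exists_fixed_unit_not_norm_of_isRamifiedQuadraticDatum`) by the graded step of §1. [cite: Serre1979, Ch. V §3 Cor. 3] [cite: NeukirchANT1999, Ch. V (1.3)] -/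
theorem exists_fixed_unit_not_norm_of_level {K : Type} [Field K] [Valued K ℤᵐ⁰] [IsAdicComplete 𝓂[K] 𝒪[K]] [Finite 𝓀[K]]
    (σ : K →+* K) (ϖ : K) (d t : ℕ) (hD : IsRamifiedQuadraticDatum σ ϖ d t) {n : ℕ} (hn : n + 1 ≤ d) :
    ∃ u : K, σ u = u ∧ Valued.v u = 1 ∧ Valued.v (u - 1) ≤ exp (-(2 * (n : ℤ))) ∧ ¬ ∃ z : K, z * σ z = u := by
  have hD' := hD
  obtain ⟨hσ, hvσ, hϖ, hfix, hd, -, ht⟩ := hD'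
  induction n with
  | zero =>
    obtain ⟨u, hσu, hu1, hun⟩ := exists_fixed_unit_not_norm_of_isRamifiedQuadraticDatum σ ϖ d t hD
    refine ⟨u, hσu, hu1, ?_, hun⟩
    calc Valued.v (u - 1) ≤ max (Valued.v u) (Valued.v (1 : K)) := Valuation.map_sub _ _ _
      _ = exp (-(2 * ((0 : ℕ) : ℤ))) := by rw [hu1, map_one, max_self]; simp
  | succ n ih =>
    obtain ⟨w, hσw, hw1, hw, hwn⟩ := ih (by omega)
    exact exists_fixed_unit_not_norm_succ_level hσ hvσ hfix hϖ hd ht (by omega) hσw hw1 hw hwn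

/-- **The same in `|ϖ^{2n}|`-currency**: for `n + 1 ≤ d` a `σ`-fixed unit `u` with `|u − 1| ≤ |ϖ ^ (2n)|` which is not a norm — the form consumed by the ★ fixed-unit-stabiliser
lemmas (`u ∈ S_F(M_i(s,·)) ↔ |u_l − u_m| ≤ |ϖ^s|`) at `s = 2n`. [cite: Serre1979, Ch. V §3 Cor. 3] [cite: NeukirchANT1999, Ch. V (1.3)] -/
theorem exists_fixed_unit_not_norm_of_level_pow {K : Type} [Field K] [Valued K ℤᵐ⁰] [IsAdicComplete 𝓂[K] 𝒪[K]] [Finite 𝓀[K]]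
    (σ : K →+* K) (ϖ : K) (d t : ℕ) (hD : IsRamifiedQuadraticDatum σ ϖ d t) {n : ℕ} (hn : n + 1 ≤ d) :
    ∃ u : K, σ u = u ∧ Valued.v u = 1 ∧ Valued.v (u - 1) ≤ Valued.v (ϖ ^ (2 * n)) ∧ ¬ ∃ z : K, z * σ z = u := by
  obtain ⟨u, hσu, hu1, hu, hun⟩ := exists_fixed_unit_not_norm_of_level σ ϖ d t hD hn
  refine ⟨u, hσu, hu1, hu.trans_eq ?_, hun⟩
  rw [map_pow, v_varpi_pow hD.2.2.1]
  push_cast; ring_nf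

end Literature.NumberTheory.LocalFields.WildQuadraticDatum
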